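import Summits.ValiantsHypothesis.ValiantsHypothesis.Theorems.CirculantFourierHrubesBridgeGates

/-!
# Hrubeš's bridge (route `CirculantFourier`, item `HrubesBridge`), part B: the representation

Support file for item `stmt-ValiantsHypothesis-6309`
(`Summit.ValiantsHypothesis.ValiantsHypothesis.Theses.CirculantFourier.HrubesBridge`, Hrubeš 2020,
*On ε-sensitive monotone computations*, Thm. 1).

The invariant of the one-pass simulation (local notation `Rep[gs, d, w]`): a real polynomial `w`
is represented after the plain gate list `gs` over `ℝ≥0` up to degree `d` if for every `k ≤ d`
there are available `P_k, Q_k ∈ ℝ≥0[x]` and `c_k ≥ 0` with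

* `P_k - Q_k = w^{(k)}` (degree-`k` homogeneous component of `w`), and
* `P_k + Q_k = c_k · L^k`, `L = Σ_i x_i` (so `Q_k` is the "complement" `c_k L^k - P_k` of
  Hrubeš's Lemma 22, carried along instead of reconstructed).

Closure: `0`, constants (`γ = γ₊ - γ₋`), variables (`x_j = (x_j + ½Σ_{i≠j} x_i) - ½Σ_{i≠j} x_i`,
`≤ #σ + 2` gates), sums (`2(d+1)` gates), real scalar multiples (negation swaps `P, Q`;
`6(d+1)` gates), products (convolution `P_k = Σ_a (P'_a P''_{k-a} + Q'_a Q''_{k-a})`,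
`Q_k = Σ_a (P'_a Q''_{k-a} + Q'_a P''_{k-a})`; `8(d+1)²` gates). Hence every gate value of a real
fan-in-two circuit with `s` gates is represented by a plain gate list of length
`≤ s · 2(#σ + 2 + 8(d+1)²)` (`rep_gates`) — Hrubeš's Lemma 22 and Lemma 23 (with the homogenisation
`O(s d²)`) in one pass.

No definitions are introduced (local notations only).
-/

noncomputable section

-- `Summit.ValiantsHypothesis.ValiantsHypothesis.…` is the tree's mandated layout (Sub = Summit).
set_option linter.dupNamespace false

namespace Summit.ValiantsHypothesis.ValiantsHypothesis.Theorems.CirculantFourierHrubes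

open MvPolynomial Literature.Computability.AlgebraicComplexity ArithCircuit
  Literature.Barriers.ValiantsHypothesis
open scoped NNReal

variable {σ : Type*}

/-- `Good[gs]` (local notation, not a definition): every gate of `gs` has fan-in `≤ 2` and is
plain. -/
local notation3 (prettyPrint := false) "Good[" gs "]" =>
  ∀ g ∈ (gs : List (Gate ℝ≥0 _)), Gate.fanIn g ≤ 2 ∧ IsPlainGate g

/-- `Av[gs, a]` (local notation, not a definition): some operand referring only to gates of `gs`
evaluates to `a` against the values of `gs`. -/
local notation3 (prettyPrint := false) "Av[" gs ", " a "]" =>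
  ∃ u : Operand ℝ≥0 _, Operand.RefsBelow (List.length gs) u ∧ Operand.eval (gateValues gs) u = a

/-- `Rep[gs, d, w]` (local notation, not a definition): the real polynomial `w` is *represented*
after the gates `gs` up to degree `d` — for every `k ≤ d` there are available polynomials
`P_k, Q_k` over `ℝ≥0` with `P_k - Q_k = w^{(k)}` (the degree-`k` homogeneous component) and
`P_k + Q_k = c_k · (Σ_i x_i)^k`. -/
local notation3 (prettyPrint := false) "Rep[" gs ", " d ", " w "]" =>
  ∃ (P Q : ℕ → MvPolynomial _ ℝ≥0) (c : ℕ → ℝ≥0), ∀ k ≤ (d : ℕ),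
    Av[gs, P k] ∧ Av[gs, Q k] ∧
    MvPolynomial.map NNReal.toRealHom (P k) - MvPolynomial.map NNReal.toRealHom (Q k) =
      MvPolynomial.homogeneousComponent k w ∧
    P k + Q k = c k • (∑ i, MvPolynomial.X i) ^ k

section Rep

variable [Fintype σ]

/-- Representation is stable under appending gates. -/
theorem rep_mono {gs : List (Gate ℝ≥0 σ)} (gs' : List (Gate ℝ≥0 σ)) {d : ℕ}
    {w : MvPolynomial σ ℝ} (h : Rep[gs, d, w]) : Rep[gs ++ gs', d, w] := by
  obtain ⟨P, Q, c, h⟩ := h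
  refine ⟨P, Q, c, fun k hk => ?_⟩
  obtain ⟨h1, h2, h3, h4⟩ := h k hk
  exact ⟨av_mono gs' h1, av_mono gs' h2, h3, h4⟩

/-- `0` is represented. -/
theorem rep_zero (gs : List (Gate ℝ≥0 σ)) (d : ℕ) : Rep[gs, d, (0 : MvPolynomial σ ℝ)] :=
  ⟨fun _ => 0, fun _ => 0, fun _ => 0, fun k _ => ⟨av_zero gs, av_zero gs, by simp, by simp⟩⟩

/-- Constants are represented (positive and negative parts). -/
theorem rep_C (gs : List (Gate ℝ≥0 σ)) (d : ℕ) (γ : ℝ) :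
    Rep[gs, d, (C γ : MvPolynomial σ ℝ)] := by
  refine ⟨fun k => if k = 0 then C (Real.toNNReal γ) else 0,
    fun k => if k = 0 then C (Real.toNNReal (-γ)) else 0,
    fun k => if k = 0 then Real.toNNReal γ + Real.toNNReal (-γ) else 0, fun k _ => ?_⟩
  have hC : homogeneousComponent k (C γ : MvPolynomial σ ℝ) = if k = 0 then C γ else 0 :=
    homogeneousComponent_of_mem (isHomogeneous_C σ γ)
  by_cases hk : k = 0
  · subst hk
    simp only [↓reduceIte]
    refine ⟨av_C gs _, av_C gs _, ?_, ?_⟩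
    · rw [hC, if_pos rfl, map_C, map_C, ← C_sub]
      congr 1
      simp [Real.coe_toNNReal']
    · rw [pow_zero, ← C_add, C_eq_smul_one]
  · simp only [hk, ↓reduceIte]
    refine ⟨av_zero gs, av_zero gs, ?_, by simp⟩
    rw [hC, if_neg hk]; simp

/-- Sums of represented polynomials are represented after `≤ 2 (d + 1)` new gates. -/
theorem rep_add {gs : List (Gate ℝ≥0 σ)} (hgs : Good[gs]) (d : ℕ) {w₁ w₂ : MvPolynomial σ ℝ}
    (h₁ : Rep[gs, d, w₁]) (h₂ : Rep[gs, d, w₂]) :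
    ∃ gs' : List (Gate ℝ≥0 σ), Good[gs ++ gs'] ∧ gs'.length ≤ 2 * (d + 1) ∧
      Rep[gs ++ gs', d, w₁ + w₂] := by
  obtain ⟨P₁, Q₁, c₁, h₁⟩ := h₁
  obtain ⟨P₂, Q₂, c₂, h₂⟩ := h₂
  have hAmono : ∀ gs gs' : List (Gate ℝ≥0 σ),
      (∀ k ≤ d, Av[gs, P₁ k] ∧ Av[gs, Q₁ k] ∧ Av[gs, P₂ k] ∧ Av[gs, Q₂ k]) →
      (∀ k ≤ d, Av[gs ++ gs', P₁ k] ∧ Av[gs ++ gs', Q₁ k] ∧ Av[gs ++ gs', P₂ k] ∧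
        Av[gs ++ gs', Q₂ k]) := fun gs gs' h k hk =>
    ⟨av_mono gs' (h k hk).1, av_mono gs' (h k hk).2.1, av_mono gs' (h k hk).2.2.1,
      av_mono gs' (h k hk).2.2.2⟩
  have hA : ∀ k ≤ d, Av[gs, P₁ k] ∧ Av[gs, Q₁ k] ∧ Av[gs, P₂ k] ∧ Av[gs, Q₂ k] :=
    fun k hk => ⟨(h₁ k hk).1, (h₁ k hk).2.1, (h₂ k hk).1, (h₂ k hk).2.1⟩
  obtain ⟨gs₁, hg₁, hl₁, hA₁, hs₁⟩ := ext_family hgs d 1 _ hAmono hA (fun k => P₁ k + P₂ k)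
    (fun gs' hg' hA' k hk => ext_add hg' (hA' k hk).1 (hA' k hk).2.2.1)
  obtain ⟨gs₂, hg₂, hl₂, -, hs₂⟩ := ext_family hg₁ d 1 _ hAmono hA₁ (fun k => Q₁ k + Q₂ k)
    (fun gs' hg' hA' k hk => ext_add hg' (hA' k hk).2.1 (hA' k hk).2.2.2)
  refine ⟨gs₁ ++ gs₂, by simpa only [List.append_assoc] using hg₂, ?_,
    fun k => P₁ k + P₂ k, fun k => Q₁ k + Q₂ k, fun k => c₁ k + c₂ k, fun k hk => ⟨?_, ?_, ?_, ?_⟩⟩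
  · rw [List.length_append]; omega
  · rw [← List.append_assoc]; exact av_mono gs₂ (hs₁ k hk)
  · rw [← List.append_assoc]; exact hs₂ k hk
  · obtain ⟨-, -, e₁, -⟩ := h₁ k hk
    obtain ⟨-, -, e₂, -⟩ := h₂ k hk
    rw [map_add, map_add, map_add, ← e₁, ← e₂]
    ring
  · obtain ⟨-, -, -, f₁⟩ := h₁ k hk
    obtain ⟨-, -, -, f₂⟩ := h₂ k hk
    rw [add_add_add_comm, f₁, f₂, add_smul]

/-- Real scalar multiples of represented polynomials are represented after `≤ 6 (d + 1)` new
gates (a negative scalar swaps the roles of `P` and `Q`). -/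
theorem rep_smul {gs : List (Gate ℝ≥0 σ)} (hgs : Good[gs]) (d : ℕ) (γ : ℝ)
    {w : MvPolynomial σ ℝ} (h : Rep[gs, d, w]) :
    ∃ gs' : List (Gate ℝ≥0 σ), Good[gs ++ gs'] ∧ gs'.length ≤ 6 * (d + 1) ∧
      Rep[gs ++ gs', d, γ • w] := by
  obtain ⟨P, Q, c, h⟩ := h
  have hAmono : ∀ gs gs' : List (Gate ℝ≥0 σ), (∀ k ≤ d, Av[gs, P k] ∧ Av[gs, Q k]) →
      (∀ k ≤ d, Av[gs ++ gs', P k] ∧ Av[gs ++ gs', Q k]) := fun gs gs' h k hk =>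
    ⟨av_mono gs' (h k hk).1, av_mono gs' (h k hk).2⟩
  have hA : ∀ k ≤ d, Av[gs, P k] ∧ Av[gs, Q k] := fun k hk => ⟨(h k hk).1, (h k hk).2.1⟩
  obtain ⟨gs₁, hg₁, hl₁, hA₁, hs₁⟩ := ext_family hgs d 3 _ hAmono hA
    (fun k => C (Real.toNNReal γ) * P k + C (Real.toNNReal (-γ)) * Q k)
    (fun gs' hg' hA' k hk => ext_mul_add hg' (av_C _ _) (hA' k hk).1 (av_C _ _) (hA' k hk).2)
  obtain ⟨gs₂, hg₂, hl₂, -, hs₂⟩ := ext_family hg₁ d 3 _ hAmono hA₁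
    (fun k => C (Real.toNNReal γ) * Q k + C (Real.toNNReal (-γ)) * P k)
    (fun gs' hg' hA' k hk => ext_mul_add hg' (av_C _ _) (hA' k hk).2 (av_C _ _) (hA' k hk).1)
  have hγ : (C γ : MvPolynomial σ ℝ) = C (Real.toNNReal γ : ℝ) - C (Real.toNNReal (-γ) : ℝ) := by
    rw [← C_sub, Real.coe_toNNReal', Real.coe_toNNReal', max_zero_sub_max_neg_zero_eq_self]
  refine ⟨gs₁ ++ gs₂, by simpa only [List.append_assoc] using hg₂, ?_,
    fun k => C (Real.toNNReal γ) * P k + C (Real.toNNReal (-γ)) * Q k,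
    fun k => C (Real.toNNReal γ) * Q k + C (Real.toNNReal (-γ)) * P k,
    fun k => (Real.toNNReal γ + Real.toNNReal (-γ)) * c k, fun k hk => ⟨?_, ?_, ?_, ?_⟩⟩
  · rw [List.length_append]; omega
  · rw [← List.append_assoc]; exact av_mono gs₂ (hs₁ k hk)
  · rw [← List.append_assoc]; exact hs₂ k hk
  · obtain ⟨-, -, e, -⟩ := h k hk
    rw [LinearMap.map_smul, ← e, smul_eq_C_mul, hγ]
    simp only [map_add, map_mul, map_C, NNReal.coe_toRealHom]
    ring
  · obtain ⟨-, -, -, f⟩ := h k hk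
    calc C (Real.toNNReal γ) * P k + C (Real.toNNReal (-γ)) * Q k +
          (C (Real.toNNReal γ) * Q k + C (Real.toNNReal (-γ)) * P k)
        = (C (Real.toNNReal γ) + C (Real.toNNReal (-γ))) * (P k + Q k) := by ring
      _ = _ := by rw [f, ← C_add, smul_eq_C_mul, smul_eq_C_mul, ← mul_assoc, ← C_mul]

/-- Products of represented polynomials are represented after `≤ 8 (d + 1)²` new gates
(convolution of the components). -/
theorem rep_mul {gs : List (Gate ℝ≥0 σ)} (hgs : Good[gs]) (d : ℕ) {w₁ w₂ : MvPolynomial σ ℝ}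
    (h₁ : Rep[gs, d, w₁]) (h₂ : Rep[gs, d, w₂]) :
    ∃ gs' : List (Gate ℝ≥0 σ), Good[gs ++ gs'] ∧ gs'.length ≤ 8 * (d + 1) ^ 2 ∧
      Rep[gs ++ gs', d, w₁ * w₂] := by
  obtain ⟨P₁, Q₁, c₁, h₁⟩ := h₁
  obtain ⟨P₂, Q₂, c₂, h₂⟩ := h₂
  have hAmono : ∀ gs gs' : List (Gate ℝ≥0 σ),
      (∀ k ≤ d, Av[gs, P₁ k] ∧ Av[gs, Q₁ k] ∧ Av[gs, P₂ k] ∧ Av[gs, Q₂ k]) →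
      (∀ k ≤ d, Av[gs ++ gs', P₁ k] ∧ Av[gs ++ gs', Q₁ k] ∧ Av[gs ++ gs', P₂ k] ∧
        Av[gs ++ gs', Q₂ k]) := fun gs gs' h k hk =>
    ⟨av_mono gs' (h k hk).1, av_mono gs' (h k hk).2.1, av_mono gs' (h k hk).2.2.1,
      av_mono gs' (h k hk).2.2.2⟩
  have hA : ∀ k ≤ d, Av[gs, P₁ k] ∧ Av[gs, Q₁ k] ∧ Av[gs, P₂ k] ∧ Av[gs, Q₂ k] :=
    fun k hk => ⟨(h₁ k hk).1, (h₁ k hk).2.1, (h₂ k hk).1, (h₂ k hk).2.1⟩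
  -- one homogeneous slice of `P` resp. `Q` costs `≤ 4 (d + 1)` gates
  have slice : ∀ (swap : Bool) (gs' : List (Gate ℝ≥0 σ)), Good[gs'] →
      (∀ k ≤ d, Av[gs', P₁ k] ∧ Av[gs', Q₁ k] ∧ Av[gs', P₂ k] ∧ Av[gs', Q₂ k]) → ∀ k ≤ d,
      ∃ gs'' : List (Gate ℝ≥0 σ), Good[gs' ++ gs''] ∧ gs''.length ≤ 4 * (d + 1) ∧
        Av[gs' ++ gs'', ∑ a ∈ Finset.range (k + 1),
          if swap then P₁ a * Q₂ (k - a) + Q₁ a * P₂ (k - a)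
          else P₁ a * P₂ (k - a) + Q₁ a * Q₂ (k - a)] := by
    intro swap gs' hg' hA' k hk
    obtain ⟨gsa, hga, hla, -, hsa⟩ := ext_family hg' k 3 _ hAmono hA'
      (fun a => if swap then P₁ a * Q₂ (k - a) + Q₁ a * P₂ (k - a)
        else P₁ a * P₂ (k - a) + Q₁ a * Q₂ (k - a))
      (fun gs'' hg'' hA'' a ha => by
        cases swap
        · exact ext_mul_add hg'' (hA'' a (by omega)).1 (hA'' (k - a) (by omega)).2.2.1
            (hA'' a (by omega)).2.1 (hA'' (k - a) (by omega)).2.2.2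
        · exact ext_mul_add hg'' (hA'' a (by omega)).1 (hA'' (k - a) (by omega)).2.2.2
            (hA'' a (by omega)).2.1 (hA'' (k - a) (by omega)).2.2.1)
    obtain ⟨gsb, hgb, hlb, hsb⟩ := ext_sum (Finset.range (k + 1))
      (fun a => if swap then P₁ a * Q₂ (k - a) + Q₁ a * P₂ (k - a)
        else P₁ a * P₂ (k - a) + Q₁ a * Q₂ (k - a)) (gs' ++ gsa) hga
      (fun a ha => hsa a (by have := Finset.mem_range.mp ha; omega))
    refine ⟨gsa ++ gsb, by simpa only [List.append_assoc] using hgb, ?_, by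
      simpa only [List.append_assoc] using hsb⟩
    rw [List.length_append, Finset.card_range] at *
    have : gsb.length ≤ k + 1 := by simpa using hlb
    nlinarith
  obtain ⟨gs₁, hg₁, hl₁, hA₁, hs₁⟩ := ext_family hgs d (4 * (d + 1)) _ hAmono hA _ (slice false)
  obtain ⟨gs₂, hg₂, hl₂, -, hs₂⟩ := ext_family hg₁ d (4 * (d + 1)) _ hAmono hA₁ _ (slice true)
  simp only [Bool.false_eq_true, ↓reduceIte] at hs₁
  simp only [↓reduceIte] at hs₂
  refine ⟨gs₁ ++ gs₂, by simpa only [List.append_assoc] using hg₂, ?_,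
    fun k => ∑ a ∈ Finset.range (k + 1), (P₁ a * P₂ (k - a) + Q₁ a * Q₂ (k - a)),
    fun k => ∑ a ∈ Finset.range (k + 1), (P₁ a * Q₂ (k - a) + Q₁ a * P₂ (k - a)),
    fun k => ∑ a ∈ Finset.range (k + 1), c₁ a * c₂ (k - a), fun k hk => ⟨?_, ?_, ?_, ?_⟩⟩
  · rw [List.length_append]; nlinarith
  · rw [← List.append_assoc]; exact av_mono gs₂ (hs₁ k hk)
  · rw [← List.append_assoc]; exact hs₂ k hk
  · rw [map_sum, map_sum, ← Finset.sum_sub_distrib, homogeneousComponent_mul_eq_sum]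
    refine Finset.sum_congr rfl fun a ha => ?_
    have ha' : a ≤ k := by have := Finset.mem_range.mp ha; omega
    obtain ⟨-, -, e₁, -⟩ := h₁ a (by omega)
    obtain ⟨-, -, e₂, -⟩ := h₂ (k - a) (by omega)
    rw [← e₁, ← e₂]
    simp only [map_add, map_mul]
    ring
  · rw [← Finset.sum_add_distrib, Finset.sum_smul]
    refine Finset.sum_congr rfl fun a ha => ?_
    have ha' : a ≤ k := by have := Finset.mem_range.mp ha; omega
    obtain ⟨-, -, -, f₁⟩ := h₁ a (by omega)
    obtain ⟨-, -, -, f₂⟩ := h₂ (k - a) (by omega)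
    calc P₁ a * P₂ (k - a) + Q₁ a * Q₂ (k - a) + (P₁ a * Q₂ (k - a) + Q₁ a * P₂ (k - a))
        = (P₁ a + Q₁ a) * (P₂ (k - a) + Q₂ (k - a)) := by ring
      _ = _ := by rw [f₁, f₂, smul_mul_smul_comm, ← pow_add, Nat.add_sub_of_le ha']

variable [DecidableEq σ]

/-- Variables are represented after `≤ #σ + 2` new gates:
`x_j = (x_j + ½ Σ_{i ≠ j} x_i) - ½ Σ_{i ≠ j} x_i`. -/
theorem rep_X {gs : List (Gate ℝ≥0 σ)} (hgs : Good[gs]) (d : ℕ) (j : σ) :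
    ∃ gs' : List (Gate ℝ≥0 σ), Good[gs ++ gs'] ∧ gs'.length ≤ Fintype.card σ + 2 ∧
      Rep[gs ++ gs', d, (X j : MvPolynomial σ ℝ)] := by
  obtain ⟨gs₁, hg₁, hl₁, hS⟩ := ext_sum (Finset.univ.erase j)
    (fun i => (X i : MvPolynomial σ ℝ≥0)) gs hgs (fun i _ => av_X gs i)
  obtain ⟨gs₂, hg₂, hl₂, hH⟩ := ext_mul hg₁ (av_C _ (1 / 2)) hS
  obtain ⟨gs₃, hg₃, hl₃, hP⟩ := ext_add hg₂ (av_X _ j) hH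
  refine ⟨gs₁ ++ gs₂ ++ gs₃, by simpa only [List.append_assoc] using hg₃, ?_, ?_⟩
  · simp only [List.length_append]
    have : (Finset.univ.erase j).card ≤ Fintype.card σ :=
      (Finset.card_erase_le).trans (Finset.card_univ (α := σ)).le
    omega
  · refine ⟨fun k => if k = 1 then X j + C (1 / 2) * ∑ i ∈ Finset.univ.erase j, X i else 0,
      fun k => if k = 1 then C (1 / 2) * ∑ i ∈ Finset.univ.erase j, X i else 0,
      fun k => if k = 1 then 1 else 0, fun k _ => ?_⟩
    have hX : homogeneousComponent k (X j : MvPolynomial σ ℝ) = if k = 1 then X j else 0 :=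
      homogeneousComponent_of_mem (isHomogeneous_X ℝ j)
    by_cases hk : k = 1
    · subst hk
      simp only [↓reduceIte]
      refine ⟨by simpa only [List.append_assoc] using hP,
        by simpa only [List.append_assoc] using av_mono gs₃ hH, ?_, ?_⟩
      · rw [hX, if_pos rfl, map_add, map_X, add_sub_cancel_right]
      · rw [pow_one, one_smul, add_assoc, ← add_mul, ← C_add, add_halves, C_1, one_mul,
          Finset.add_sum_erase _ _ (Finset.mem_univ j)]
    · simp only [hk, ↓reduceIte]
      refine ⟨av_zero _, av_zero _, ?_, by simp⟩
      rw [hX, if_neg hk]; simp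

/-! ### Simulating a real fan-in-two circuit -/

/-- The value of any operand of the simulated real circuit is represented after `≤ #σ + 2` new
gates. -/
theorem rep_operand {gs : List (Gate ℝ≥0 σ)} (hgs : Good[gs]) (d : ℕ)
    (vals : List (MvPolynomial σ ℝ)) (hvals : ∀ w ∈ vals, Rep[gs, d, w]) (u : Operand ℝ σ) :
    ∃ gs' : List (Gate ℝ≥0 σ), Good[gs ++ gs'] ∧ gs'.length ≤ Fintype.card σ + 2 ∧
      Rep[gs ++ gs', d, u.eval vals] := by
  cases u with
  | var j => exact rep_X hgs d j
  | const γ => exact ⟨[], by simpa using hgs, by simp, by rw [List.append_nil]; exact rep_C gs d γ⟩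
  | gate j =>
    refine ⟨[], by simpa using hgs, by simp, ?_⟩
    rw [List.append_nil, Operand.eval_gate, List.getD_eq_getElem?_getD]
    by_cases hj : j < vals.length
    · rw [List.getElem?_eq_getElem hj, Option.getD_some]
      exact hvals _ (List.getElem_mem hj)
    · rw [List.getElem?_eq_none (by omega), Option.getD_none]
      exact rep_zero gs d

/-- A weighted-sum gate of the simulated circuit. -/
theorem rep_sumGate {gs : List (Gate ℝ≥0 σ)} (hgs : Good[gs]) (d : ℕ)
    (vals : List (MvPolynomial σ ℝ)) (hvals : ∀ w ∈ vals, Rep[gs, d, w])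
    (args : List (ℝ × Operand ℝ σ)) :
    ∃ gs' : List (Gate ℝ≥0 σ), Good[gs ++ gs'] ∧
      gs'.length ≤ args.length * (Fintype.card σ + 2 + 8 * (d + 1)) ∧
      Rep[gs ++ gs', d, (args.map fun a => a.1 • a.2.eval vals).sum] := by
  induction args with
  | nil => exact ⟨[], by simpa using hgs, by simp, by simpa using rep_zero gs d⟩
  | cons a args ih =>
    obtain ⟨gs₁, hg₁, hl₁, hr₁⟩ := ih
    obtain ⟨gs₂, hg₂, hl₂, hr₂⟩ :=
      rep_operand hg₁ d vals (fun w hw => rep_mono gs₁ (hvals w hw)) a.2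
    obtain ⟨gs₃, hg₃, hl₃, hr₃⟩ := rep_smul hg₂ d a.1 hr₂
    have hr₁' : Rep[gs ++ gs₁ ++ gs₂ ++ gs₃, d, (args.map fun a => a.1 • a.2.eval vals).sum] := by
      simpa only [List.append_assoc] using rep_mono (gs₂ ++ gs₃) hr₁
    obtain ⟨gs₄, hg₄, hl₄, hr₄⟩ := rep_add hg₃ d hr₃ hr₁'
    refine ⟨gs₁ ++ gs₂ ++ gs₃ ++ gs₄, by simpa only [List.append_assoc] using hg₄, ?_, ?_⟩
    · simp only [List.length_append, List.length_cons]
      nlinarith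
    · rw [List.map_cons, List.sum_cons]
      simpa only [List.append_assoc] using hr₄

/-- A product gate of the simulated circuit. -/
theorem rep_prodGate {gs : List (Gate ℝ≥0 σ)} (hgs : Good[gs]) (d : ℕ)
    (vals : List (MvPolynomial σ ℝ)) (hvals : ∀ w ∈ vals, Rep[gs, d, w])
    (args : List (Operand ℝ σ)) :
    ∃ gs' : List (Gate ℝ≥0 σ), Good[gs ++ gs'] ∧
      gs'.length ≤ args.length * (Fintype.card σ + 2 + 8 * (d + 1) ^ 2) ∧
      Rep[gs ++ gs', d, (args.map fun u => u.eval vals).prod] := by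
  induction args with
  | nil => exact ⟨[], by simpa using hgs, by simp, by simpa using rep_C gs d 1⟩
  | cons u args ih =>
    obtain ⟨gs₁, hg₁, hl₁, hr₁⟩ := ih
    obtain ⟨gs₂, hg₂, hl₂, hr₂⟩ :=
      rep_operand hg₁ d vals (fun w hw => rep_mono gs₁ (hvals w hw)) u
    have hr₁' : Rep[gs ++ gs₁ ++ gs₂, d, (args.map fun u => u.eval vals).prod] := by
      simpa only [List.append_assoc] using rep_mono gs₂ hr₁
    obtain ⟨gs₃, hg₃, hl₃, hr₃⟩ := rep_mul hg₂ d hr₂ hr₁'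
    refine ⟨gs₁ ++ gs₂ ++ gs₃, by simpa only [List.append_assoc] using hg₃, ?_, ?_⟩
    · simp only [List.length_append, List.length_cons]
      nlinarith
    · rw [List.map_cons, List.prod_cons]
      simpa only [List.append_assoc] using hr₃

/-- One gate of fan-in `≤ 2` of the simulated circuit costs `≤ 2 (#σ + 2 + 8 (d + 1)²)` gates. -/
theorem rep_gate {gs : List (Gate ℝ≥0 σ)} (hgs : Good[gs]) (d : ℕ)
    (vals : List (MvPolynomial σ ℝ)) (hvals : ∀ w ∈ vals, Rep[gs, d, w])
    (g : Gate ℝ σ) (hg : g.fanIn ≤ 2) :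
    ∃ gs' : List (Gate ℝ≥0 σ), Good[gs ++ gs'] ∧
      gs'.length ≤ 2 * (Fintype.card σ + 2 + 8 * (d + 1) ^ 2) ∧
      Rep[gs ++ gs', d, g.eval vals] := by
  have hd : d + 1 ≤ (d + 1) ^ 2 := Nat.le_self_pow two_ne_zero _
  cases g with
  | sum args =>
    obtain ⟨gs', h1, h2, h3⟩ := rep_sumGate hgs d vals hvals args
    have hlen : args.length ≤ 2 := by simpa [Gate.fanIn, Gate.args] using hg
    refine ⟨gs', h1, ?_, h3⟩
    calc gs'.length ≤ args.length * (Fintype.card σ + 2 + 8 * (d + 1)) := h2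
      _ ≤ 2 * (Fintype.card σ + 2 + 8 * (d + 1) ^ 2) := by
        calc args.length * (Fintype.card σ + 2 + 8 * (d + 1))
            ≤ 2 * (Fintype.card σ + 2 + 8 * (d + 1)) := Nat.mul_le_mul_right _ hlen
          _ ≤ 2 * (Fintype.card σ + 2 + 8 * (d + 1) ^ 2) := by
            apply Nat.mul_le_mul_left; omega
  | prod args =>
    obtain ⟨gs', h1, h2, h3⟩ := rep_prodGate hgs d vals hvals args
    have hlen : args.length ≤ 2 := by simpa [Gate.fanIn, Gate.args] using hg
    refine ⟨gs', h1, ?_, h3⟩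
    exact h2.trans (Nat.mul_le_mul_right _ hlen)

/-- **Simulation of a real fan-in-two circuit**: every gate value of a gate list `gs₀` over `ℝ`
is represented by a plain monotone gate list over `ℝ≥0` of length
`≤ |gs₀| · 2 (#σ + 2 + 8 (d + 1)²)`. -/
theorem rep_gates (d : ℕ) (gs₀ : List (Gate ℝ σ)) (h : ∀ g ∈ gs₀, g.fanIn ≤ 2) :
    ∃ gs : List (Gate ℝ≥0 σ), Good[gs] ∧
      gs.length ≤ gs₀.length * (2 * (Fintype.card σ + 2 + 8 * (d + 1) ^ 2)) ∧
      ∀ w ∈ gateValues gs₀, Rep[gs, d, w] := by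
  induction gs₀ using List.reverseRecOn with
  | nil => exact ⟨[], good_nil, by simp, fun w hw => by simp [gateValues] at hw⟩
  | append_singleton gs₀ g ih =>
    obtain ⟨gs, hg, hl, hr⟩ := ih (fun g' hg' => h g' (List.mem_append_left _ hg'))
    obtain ⟨gs', hg', hl', hr'⟩ := rep_gate hg d (gateValues gs₀) hr g (h g (by simp))
    refine ⟨gs ++ gs', hg', ?_, ?_⟩
    · simp only [List.length_append, List.length_singleton]
      nlinarith
    · intro w hw
      rw [gateValues_append_singleton, List.mem_append, List.mem_singleton] at hw
      rcases hw with hw | rfl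
      · exact rep_mono gs' (hr w hw)
      · exact hr'

end Rep

end Summit.ValiantsHypothesis.ValiantsHypothesis.Theorems.CirculantFourierHrubes
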